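import Literature.AlgebraicGeometry.AbelianSchemes.AbelianSchemeLDeltaFibreH1Vanishing
import Literature.AlgebraicGeometry.AbelianSchemes.AbelianSchemeBaseChangeComp
import Literature.AlgebraicGeometry.AbelianSchemes.AbelianSchemeIsLambdaOfAtBaseChange
import Literature.AlgebraicGeometry.Modules.RankOneModuleDivisorDictionary
import Literature.AlgebraicGeometry.Modules.PullbackFrame
import HarnessLib

/-!
# `L^Δ(λ) = (1, λ)^*𝒫` of a polarisation is NONDEGENERATE: rigidified along `ε`, and on every geometric fibre the class of an
# ample divisor ([MumfordFogartyKirwan1994] Ch. 6 §2 Def. 6.2–6.3, Prop. 6.10; [MumfordAV1970] §13)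

Layer `Literature/AlgebraicGeometry/AbelianSchemes`, namespace `Literature.AlgebraicGeometry.AbelianSchemes.AbelianSchemeOver`.
THEOREMS ONLY (no definition, no named fact, no instance, no notation, no `sorry`).  Cell `hodgecm-mathlib` (D-0151), F-11 α1
grandchild `F11LiftWithLineBundle`, MONO-G2 brick **B10** (F0P1b-plan (g0) R53 #6; consumer F0P1b-p03 (g0), step (7) of
`G2_principal_of_sockets`): the two NONDEGENERACY HYPOTHESES `hε` (rigidification) and `hΘ` (geometrically of the class of an ample
divisor) under which the tree's `K(L)` files (★ `exists_kOfL_formallyUnramified`) and the (I2)∕(I1) letters (★ `PhiLInjectiveCharZero`)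
are stated, DISCHARGED for the line bundle `L^Δ(λ) := Gr^*𝒫` of a polarisation `λ` (`Gr = (1_A, λ) : A → A ×_S Â` a variable with its
two projections, the convention of ★ `AbelianSchemeLDeltaOfLambda`) and for its base change `L_s := p^*L^Δ(λ)` to a field-valued point
`b : Spec k → S` (`p : A_b → A` the projection) — the shape in which the consumer meets it (`A := A₀.baseChange sk`).

* §1 **`Polarization.cechPic_pullback_unitSection_detClass_LDelta_eq_one`** — `ε_A^*[L^Δ(λ)] = 1`: the graph of the HOMOMORPHISM `λ`
  sends the unit section to `(ε_A, ε_Â) = ε_Â ≫ (ε_A × 1_Â)` (`IsMonHom.one_hom`), along which `𝒫` is trivial (the rigidification clause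
  of the dual pair, ★ `DualPair.rigid`) — the proof of ★ `LDeltaCubeOfLinearRigidification.cechPic_pullback_unitSection_detClass_LDelta_eq_one`
  for a bare polarised `(A, D, λ)` (no level structure);
* §2 **`Polarization.exists_isAmple_pullback_fst_detClass_LDelta_eq_cechClass`** — at every geometric point `s` of `S` there is an AMPLE
  Cartier divisor `Θ′` on `A_s` with `ι_s^*[L^Δ(λ)] = [Θ′]`: `Θ′ := Θ + (−1)^*Θ` for the ample witness `Θ` of `λ̄_s = Λ(𝒪(Θ))`
  (★ `Polarization.exists_ample`), by ★ `detClass_restrict_LDelta_eq_cechClass_add_pullback_neg` ([MumfordFogartyKirwan1994] Prop. 6.10: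
  «`L^Δ(λ) ≅ Δ^*{μ^*L ⊗ p₁^*L⁻¹ ⊗ p₂^*L⁻¹}`», class `[Θ] + [(−1)^*Θ]`) and ★ `IsAmple.add`∕`IsAmple.pullback`;
* §3 base change to a field point `b : Spec k → S` (`A_b = A.baseChange b`, `p = pullback.fst`, `L_s = p^*(Gr^*𝒫)`, ANY rank-one proof
  `hL`): **`Polarization.cechPic_pullback_unitSection_detClass_pullback_LDelta_eq_one`** (`ε_{A_b}^*[L_s] = 1`, ★
  `unitSection_baseChange_comp_fst`) and **`Polarization.exists_isAmple_pullback_fst_detClass_pullback_LDelta_eq_cechClass`** (at every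
  geometric point `s` of `Spec k`, an ample `Θ` on `(A_b)_s` with `ι_s^*[L_s] = [Θ]`, transported from §2 at `s ≫ b` along ★
  `fibreBaseChangeIso`), and the conjunction **`Polarization.LDelta_baseChange_nondegenerate`** — the `hε`∕`hΘ` binders of ★
  `AbelianSchemeOver.vectorField_eq_zero_of_contracted_dlog_coboundary` ∕ ★ `exists_kOfL_formallyUnramified` VERBATIM for `A := A.baseChange b`.

HC_CM is proved only modulo the 7 printed citations until rung 0 closes; this file is generic abelian-scheme geometry and asserts
nothing about HC.

## References
* [MumfordFogartyKirwan1994] D. Mumford, J. Fogarty, F. Kirwan, *Geometric Invariant Theory*, 3rd ed. (1994), Ch. 6 §2 Definition 6.2–6.3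
  (p. 120), Proposition 6.10 and its proof (p. 121); Ch. 6 §1 Cor. 6.8 (p. 118).
* [MumfordAV1970] D. Mumford, *Abelian Varieties* (1970), §13 (p. 123), §6 Application 1 (p. 60).
* [GortzWedhorn2023] U. Görtz, T. Wedhorn, *Algebraic Geometry II* (2023), Rem. 27.185 (p. 674).
* [GortzWedhorn2020] U. Görtz, T. Wedhorn, *Algebraic Geometry I*, 2nd ed. (2020), Section (4.7) (pp. 107–108), Prop. 13.66 (2) (p. 402).
* [Hartshorne1977] R. Hartshorne, *Algebraic Geometry* (1977), II Ex. 6.8 (a), III Ex. 4.5.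
-/

-- `Scheme.Modules` / `SheafOfModules` are not reducible (as in ★ `AbelianSchemeLDeltaOfLambda`).
set_option backward.isDefEq.respectTransparency false

noncomputable section

open CategoryTheory CategoryTheory.Limits AlgebraicGeometry MonoidalCategory CartesianMonoidalCategory

universe u

namespace Literature.AlgebraicGeometry.AbelianSchemes

open Literature.AlgebraicGeometry.Motives Literature.AlgebraicGeometry.Modules
  Literature.AlgebraicGeometry.AbelianVarieties

namespace AbelianSchemeOver

variable {S : Scheme.{u}} (A : AbelianSchemeOver S) {D : A.DualPair} (pol : A.Polarization D)
  (Gr : A.X.left ⟶ A.prodLeft D.hat) (hGr₁ : Gr ≫ pullback.fst A.X.hom D.hat.X.hom = 𝟙 _)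
  (hGr₂ : Gr ≫ pullback.snd A.X.hom D.hat.X.hom = pol.lam.left)

/-! ## §1 `L^Δ(λ)` is rigidified along the unit section -/

/-- `L^Δ(λ) = Gr^*𝒫` is of rank one. [cite: MumfordFogartyKirwan1994, Ch. 6 §2 Definition 6.2 (p. 120)] -/
theorem hasRank_pullback_graph_P : HasRank ((Scheme.Modules.pullback Gr).obj D.P) 1 :=
  hasRank_pullback Gr D.hasRank_one

open scoped MonObj in
include hGr₁ hGr₂ in
/-- The graph of the homomorphism `λ` sends the unit section to `(ε_A, ε_Â) = ε_Â ≫ (ε_A × 1_Â)`.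
[cite: MumfordFogartyKirwan1994, Ch. 6 §2 Definition 6.2 (p. 120)] -/
theorem Polarization.unitSection_comp_graph : A.unitSection ≫ Gr = D.hat.unitSection ≫ A.unitSlice D.hat := by
  haveI := pol.isMonHom
  apply pullback.hom_ext
  · rw [Category.assoc, hGr₁, Category.comp_id, Category.assoc, AbelianSchemeOver.unitSlice_fst, ← Category.assoc,
      D.hat.unitSection_comp_hom, Category.id_comp]
  · rw [Category.assoc, hGr₂, Category.assoc, AbelianSchemeOver.unitSlice_snd, Category.comp_id]
    change (η[A.X]).left ≫ pol.lam.left = (η[D.hat.X]).left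
    rw [← Over.comp_left, IsMonHom.one_hom]

include hGr₁ hGr₂ in
/-- **`ε_A^*[L^Δ(λ)] = 1` in `Ȟ¹(S, 𝒪^×)`** — `L^Δ(λ) = Gr^*𝒫` is RIGIDIFIED along the unit section: `ε_A ≫ Gr = ε_Â ≫ (ε_A × 1_Â)`
and `𝒫` is trivial along `ε_A × 1_Â` (the rigidification clause of the dual pair).  The `hε` binder of the tree's `K(L)` files for
`L := L^Δ(λ)` (any proof `h` of finite local freeness). [cite: MumfordFogartyKirwan1994, Ch. 6 §2 Definition 6.2 (p. 120)]
[cite: Hartshorne1977, III Ex. 4.5] -/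
theorem Polarization.cechPic_pullback_unitSection_detClass_LDelta_eq_one
    (h : IsFiniteLocallyFree ((Scheme.Modules.pullback Gr).obj D.P)) :
    CechPic.pullback A.unitSection (detClass h) = 1 := by
  obtain ⟨r⟩ := D.rigid
  rw [(detClass_eq_of_iso (Iso.refl _) h ((HasRank.isFiniteLocallyFree' D.hasRank_one).pullback Gr)).trans
      (detClass_pullback Gr (HasRank.isFiniteLocallyFree' D.hasRank_one)),
    ← CechPic.pullback_comp, pol.unitSection_comp_graph A Gr hGr₁ hGr₂, CechPic.pullback_comp,
    ← detClass_pullback (A.unitSlice D.hat) (HasRank.isFiniteLocallyFree' D.hasRank_one),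
    detClass_eq_of_iso r ((HasRank.isFiniteLocallyFree' D.hasRank_one).pullback _)
      (HasRank.isFiniteLocallyFree' hasRank_unitModule),
    detClass_unitModule_eq_one, map_one]

/-! ## §2 On every geometric fibre, `L^Δ(λ)` is the class of an ample divisor -/

include hGr₁ hGr₂ in
/-- **On every geometric fibre `L^Δ(λ)` is the class of an AMPLE Cartier divisor**: at a geometric point `s` of `S` (`Ω` algebraically
closed) with ample witness `Θ` of `λ̄_s = Λ(𝒪(Θ))` (★ `Polarization.exists_ample`), `ι_s^*[L^Δ(λ)] = [Θ + (−1)^*Θ]`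
(★ `detClass_restrict_LDelta_eq_cechClass_add_pullback_neg`) and `Θ + (−1)^*Θ` is ample.  The `hΘ` binder of the tree's `K(L)` files and of
the (I2)∕(I1) letters for `L := L^Δ(λ)` (any proof `h` of finite local freeness).
[cite: MumfordFogartyKirwan1994, Ch. 6 §2 Proposition 6.10, proof (p. 121) and Definition 6.3 (p. 120)] [cite: GortzWedhorn2023, Rem. 27.185 (p. 674)] -/
theorem Polarization.exists_isAmple_pullback_fst_detClass_LDelta_eq_cechClass
    (h : IsFiniteLocallyFree ((Scheme.Modules.pullback Gr).obj D.P))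
    {Ω : Type u} [Field Ω] [IsAlgClosed Ω] (s : Spec (.of Ω) ⟶ S) :
    ∃ Θ : CartierDivisor (A.fibre s).toAbelianVariety.X.left, Θ.IsAmple ∧
      CechPic.pullback (X := (A.fibre s).toAbelianVariety.X.left) (pullback.fst A.X.hom s) (detClass h) = Θ.cechClass := by
  obtain ⟨Θ, hΘ, hΛ⟩ := pol.exists_ample Ω s
  let B := (A.fibre s).toAbelianVariety
  let ν : B.X.left ⟶ B.X.left := AbelianVariety.Hom.toSchemeHom (-𝟙 B)
  have hνν : ν ≫ ν = 𝟙 B.X.left := by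
    change AbelianVariety.Hom.toSchemeHom ((-𝟙 B) ≫ (-𝟙 B)) = 𝟙 B.X.left
    rw [Preadditive.neg_comp_neg, Category.comp_id]
    rfl
  haveI : IsIso ν := ⟨ν, hνν, hνν⟩
  refine ⟨Θ + Θ.pullback ν, hΘ.add (hΘ.pullback ν), ?_⟩
  exact (detClass_pullback (pullback.fst A.X.hom s) h).symm.trans
    (A.detClass_restrict_LDelta_eq_cechClass_add_pullback_neg D s rfl hΛ Gr hGr₁ hGr₂ _)

/-! ## §3 Base change to a field-valued point: the `hε` ∕ `hΘ` letters for `L_s := p^*L^Δ(λ)` on `A_b` -/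

section FieldPoint

variable {k : Type u} [Field k] (b : Spec (.of k) ⟶ S)

include hGr₁ hGr₂ in
/-- **`ε_{A_b}^*[p^*L^Δ(λ)] = 1`** on the base change `A_b = A ×_S Spec k` along a field-valued point `b` (`p : A_b → A` the projection):
`ε_{A_b} ≫ p = b ≫ ε_A` (★ `unitSection_baseChange_comp_fst`) and §1.  The `hε` binder for `A := A.baseChange b`,
`L := p^*L^Δ(λ)`, stated for ANY rank-one proof `hL` (the letters' `HasRank.isFiniteLocallyFree' hL`).
[cite: MumfordFogartyKirwan1994, Ch. 6 §2 Definition 6.2 (p. 120) and Ch. 6 §1 Cor. 6.8 (p. 118)] -/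
theorem Polarization.cechPic_pullback_unitSection_detClass_pullback_LDelta_eq_one
    (hL : HasRank ((Scheme.Modules.pullback (X := (A.baseChange b).X.left) (pullback.fst A.X.hom b)).obj
      ((Scheme.Modules.pullback Gr).obj D.P)) 1) :
    CechPic.pullback (A.baseChange b).unitSection (detClass (HasRank.isFiniteLocallyFree' hL)) = 1 := by
  have hF : IsFiniteLocallyFree ((Scheme.Modules.pullback Gr).obj D.P) :=
    HasRank.isFiniteLocallyFree' (A.hasRank_pullback_graph_P Gr)
  have e : detClass (HasRank.isFiniteLocallyFree' hL) = detClass (hF.pullback (pullback.fst A.X.hom b)) := rfl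
  rw [e, detClass_pullback (pullback.fst A.X.hom b) hF]
  calc CechPic.pullback (A.baseChange b).unitSection (CechPic.pullback (pullback.fst A.X.hom b) (detClass hF))
      = CechPic.pullback ((A.baseChange b).unitSection ≫ pullback.fst A.X.hom b) (detClass hF) :=
        (CechPic.pullback_comp _ _ _).symm
    _ = CechPic.pullback (b ≫ A.unitSection) (detClass hF) := by rw [A.unitSection_baseChange_comp_fst b]
    _ = 1 := by
        rw [CechPic.pullback_comp, pol.cechPic_pullback_unitSection_detClass_LDelta_eq_one A Gr hGr₁ hGr₂ hF, map_one]

include hGr₁ hGr₂ in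
/-- **On every geometric fibre of `A_b`, `p^*L^Δ(λ)` is the class of an AMPLE divisor**: at a geometric point `s` of `Spec k`, the ample
divisor of §2 at the geometric point `s ≫ b` of `S`, transported along the identification `(A_b)_s ≅ A_{s ≫ b}` (★ `fibreBaseChangeIso`,
compatible with the projections; pull-back of an ample divisor along an isomorphism is ample, ★ `IsAmple.pullback`, and has the
pulled-back class, ★ `CartierDivisor.cechClass_pullback`).  The `hΘ` binder for `A := A.baseChange b`, `L := p^*L^Δ(λ)`, any `hL`.
[cite: MumfordFogartyKirwan1994, Ch. 6 §2 Proposition 6.10 (p. 121) and Definition 6.3 (p. 120)] [cite: GortzWedhorn2020, Section (4.7) (pp. 107–108) and Prop. 13.66 (2) (p. 402)] -/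
theorem Polarization.exists_isAmple_pullback_fst_detClass_pullback_LDelta_eq_cechClass
    (hL : HasRank ((Scheme.Modules.pullback (X := (A.baseChange b).X.left) (pullback.fst A.X.hom b)).obj
      ((Scheme.Modules.pullback Gr).obj D.P)) 1)
    {Ω : Type u} [Field Ω] [IsAlgClosed Ω] (s : Spec (.of Ω) ⟶ Spec (.of k)) :
    ∃ Θ : CartierDivisor ((A.baseChange b).fibre s).toAbelianVariety.X.left, Θ.IsAmple ∧
      CechPic.pullback (X := ((A.baseChange b).fibre s).toAbelianVariety.X.left) (pullback.fst (A.baseChange b).X.hom s)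
        (detClass (HasRank.isFiniteLocallyFree' hL)) = Θ.cechClass := by
  have hF : IsFiniteLocallyFree ((Scheme.Modules.pullback Gr).obj D.P) :=
    HasRank.isFiniteLocallyFree' (A.hasRank_pullback_graph_P Gr)
  obtain ⟨Θ, hΘ, hcl⟩ := pol.exists_isAmple_pullback_fst_detClass_LDelta_eq_cechClass A Gr hGr₁ hGr₂ hF (s ≫ b)
  -- transport along `(A_b)_s ≅ A_{s ≫ b}`
  haveI := A.isIso_toSchemeHom_fibreBaseChangeIso b s
  refine ⟨Θ.pullback (AbelianVariety.Hom.toSchemeHom (A.fibreBaseChangeIso b s).hom), hΘ.pullback _, ?_⟩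
  have e : detClass (HasRank.isFiniteLocallyFree' hL) = detClass (hF.pullback (pullback.fst A.X.hom b)) := rfl
  rw [CartierDivisor.cechClass_pullback, ← hcl, e, detClass_pullback (pullback.fst A.X.hom b) hF]
  calc CechPic.pullback _ (CechPic.pullback (pullback.fst A.X.hom b) (detClass hF))
      = CechPic.pullback (pullback.fst (A.baseChange b).X.hom s ≫ pullback.fst A.X.hom b) (detClass hF) :=
        (CechPic.pullback_comp _ _ _).symm
    _ = CechPic.pullback (AbelianVariety.Hom.toSchemeHom (A.fibreBaseChangeIso b s).hom ≫ pullback.fst A.X.hom (s ≫ b))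
          (detClass hF) :=
        congrArg (fun q => CechPic.pullback q (detClass hF)) (A.fibreBaseChangeIso_hom_toSchemeHom_fst b s).symm
    _ = _ := CechPic.pullback_comp _ _ _

include hGr₁ hGr₂ in
/-- **B10 — `L_s := p^*L^Δ(λ)` on `A_b` IS NONDEGENERATE in the letters' shape**: the `hε` and `hΘ` binders of ★
`AbelianSchemeOver.vectorField_eq_zero_of_contracted_dlog_coboundary` ((I2-a)) ∕ ★ `exists_kOfL_formallyUnramified` VERBATIM for
`A := A.baseChange b`, `L := (pullback (pullback.fst A.X.hom b)).obj ((pullback Gr).obj D.P)` and any rank-one proof `hL`.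
[cite: MumfordFogartyKirwan1994, Ch. 6 §2 Proposition 6.10 (p. 121) and Definition 6.2–6.3 (p. 120)] [cite: MumfordAV1970, §13 (p. 123)] -/
theorem Polarization.LDelta_baseChange_nondegenerate
    (hL : HasRank ((Scheme.Modules.pullback (X := (A.baseChange b).X.left) (pullback.fst A.X.hom b)).obj
      ((Scheme.Modules.pullback Gr).obj D.P)) 1) :
    CechPic.pullback (A.baseChange b).unitSection (detClass (HasRank.isFiniteLocallyFree' hL)) = 1 ∧
      ∀ ⦃Ω : Type u⦄ [Field Ω] [IsAlgClosed Ω] (s : Spec (.of Ω) ⟶ Spec (.of k)),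
        ∃ Θ : CartierDivisor ((A.baseChange b).fibre s).toAbelianVariety.X.left, Θ.IsAmple ∧
          CechPic.pullback (X := ((A.baseChange b).fibre s).toAbelianVariety.X.left) (pullback.fst (A.baseChange b).X.hom s)
            (detClass (HasRank.isFiniteLocallyFree' hL)) = Θ.cechClass :=
  ⟨pol.cechPic_pullback_unitSection_detClass_pullback_LDelta_eq_one A Gr hGr₁ hGr₂ b hL,
    fun _ _ _ s => pol.exists_isAmple_pullback_fst_detClass_pullback_LDelta_eq_cechClass A Gr hGr₁ hGr₂ b hL s⟩

/-- The rank-one proof the consumer can use for `L_s`. [cite: MumfordFogartyKirwan1994, Ch. 6 §2 Definition 6.2 (p. 120)] -/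
theorem hasRank_pullback_fst_pullback_graph_P :
    HasRank ((Scheme.Modules.pullback (X := (A.baseChange b).X.left) (pullback.fst A.X.hom b)).obj
      ((Scheme.Modules.pullback Gr).obj D.P)) 1 :=
  hasRank_pullback _ (A.hasRank_pullback_graph_P Gr)

end FieldPoint

end AbelianSchemeOver

end Literature.AlgebraicGeometry.AbelianSchemes

end
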